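import Literature.MathematicalPhysics.QuantumManyBody.PeriodicBoseGas
import Literature.Probability.Distributions.GaussianPiDensity
import Mathlib.MeasureTheory.Integral.MeanInequalities
import Mathlib.MeasureTheory.Integral.Lebesgue.Markov
import HarnessLib

/-!
# The mean self-conditional density `m₂(Ψ)` of an `N`-body wave function

Topic `Literature/MathematicalPhysics/QuantumManyBody` (definition item `defn-meanSelfDensity`,
wanted by route `BECDeletionTolerance`, items stmt-AtomisticToContinuum-4367/4369/4370/4371, which
inline the term defined here; companion of `BoseEinsteinCondensation.lean` / `PeriodicBoseGas.lean`,
namespace `Literature.MathematicalPhysics.QuantumManyBody.BoseGas`).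

For a wave function `Ψ : (ℝ³)^{n+1} → ℂ` of `N = n + 1` particles in a box of side `L`, write
`X = (x, Y)` with `x = x₁ ∈ ℝ³` the first particle and `Y = (x₂, …, x_N) ∈ (ℝ³)ⁿ` the "bath"
(`Matrix.vecCons x Y`). With the Born law `μ = |Ψ|² dX` (a probability measure when `∫ |Ψ|² = 1`),
the conditional density of the first particle given the bath is
`p(x | Y) = |Ψ(x, Y)|² / b(Y)`, `b(Y) = ∫ |Ψ(x', Y)|² dx'` (the bath marginal density), and the
**mean self-conditional density** is

  `m₂(Ψ) = L³ · E_μ[p(x₁ | x₂, …, x_N)] = L³ ∫ dY ∫ dx |Ψ(x, Y)|⁴ / ∫ dx' |Ψ(x', Y)|²`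

(`meanSelfDensity n L Ψ`, an `ℝ≥0∞`-valued double lower Lebesgue integral, literally the term the
route items inline, so that they restate by `rfl`). Probabilistically,
`m₂ = 1 + χ²(law of (x₁, Y) ‖ Unif(Λ_L) ⊗ law of Y)` when `Ψ` is normalised and supported in the
box `Λ_L^{N}`: it measures, in mean square, how well the position of one deleted particle can be
predicted from the others — a quantitative form of insertion/deletion tolerance of the point
process `|Ψ|²` in the sense of Holroyd–Soo (Electron. J. Probab. 18 (2013), Thms. 1.1–1.2), in the
one-particle-density-matrix setting of Penrose–Onsager / LSSY2005 §1.2. For the free periodic gas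
(`Ψ` constant on the cell) `m₂ = 1`, the minimum (`meanSelfDensity_prod_constantMode`,
`one_le_meanSelfDensity_of_boxN`).

## Contents

* `meanSelfDensity n L Ψ` and its `rfl` unfolding `meanSelfDensity_eq`.
* `periodicMeanSelfDensity n L Ψ := meanSelfDensity n L (1_{cell^{n+1}} Ψ)` — the periodic twin
  (same indicator convention as `condensateOccupation`), for the link with `PeriodicBEC`.
* Invariances: `meanSelfDensity_congr_nnnorm` (depends on `|Ψ|` only), `meanSelfDensity_const_mul`
  (`m₂(cΨ) = |c|² m₂(Ψ)`), phase `meanSelfDensity_const_mul_of_norm_eq_one`, modulus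
  `meanSelfDensity_norm`, complex conjugation `meanSelfDensity_conj`.
* Disintegration along the first particle `lintegral_eq_lintegral_lintegral_vecCons`
  (`∫ F dX = ∫ dY ∫ dx F(x, Y)`, Tonelli through `MeasurableEquiv.piFinSuccAbove`).
* **Jensen / Cauchy–Schwarz lower bound** `one_le_meanSelfDensity_of_support`: if `Ψ` is
  normalised and `Ψ(·, Y)` vanishes off a set of volume `≤ L³` then `1 ≤ m₂(Ψ)`; specialisations
  to the Dirichlet box `one_le_meanSelfDensity_of_boxN` and to the periodic cell
  `one_le_meanSelfDensity_of_cellN`.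
* **Product states** `meanSelfDensity_prod`: `m₂(φ^{⊗N}) = L³ ∫ |φ|⁴` for `∫ |φ|² = 1`; the free
  periodic gas `meanSelfDensity_prod_constantMode`: `m₂ = 1`.
* **Lower semicontinuity** `meanSelfDensity_le_liminf` (Fatou): `m₂(Φ) ≤ liminf m₂(Ψ_k)` when
  `Ψ_k → Φ` a.e. and the bath marginals `∫|Ψ_k(x,Y)|²dx → ∫|Φ(x,Y)|²dx` for a.e. `Y`; with the
  single-integral form `meanSelfDensity_eq_lintegral` and `quasiMeasurePreserving_tail`.

## Design choices

* `ℝ≥0∞` and division conventions: the integrand is `|Ψ(x,Y)|⁴ / b(Y)` with `ENNReal` division, so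
  bath configurations `Y` with `b(Y) = 0` (then `Ψ(·, Y) = 0` a.e.) contribute `0 · ⊤ = 0` almost
  everywhere, and `b(Y) = ⊤` (a null set of `Y` when `∫ |Ψ|² < ∞`) contributes `0`; this is the
  intended reading of the requester ("ENNReal 0/0 = 0").
* No normalisation is built in: `m₂(cΨ) = |c|² m₂(Ψ)`; the lower bound `1 ≤ m₂` assumes `∫|Ψ|² = 1`.
* The first particle is singled out (`Matrix.vecCons`), as in `occupation`; for Bose-symmetric `Ψ`
  any particle gives the same value.
* Mathlib has no such notion (searched `selfDensity`, `conditional density`, `chiSq`, `deletion`);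
  `lintegral`, `MeasurableEquiv.piFinSuccAbove`, `ENNReal.lintegral_mul_le_Lp_mul_Lq` (Hölder) are
  Mathlib's; Tonelli for finite products is `Literature.Probability.Distributions.lintegral_fin_nat_prod_eq_prod`.
* Not here: the deletion bound `N ≤ n₀(Ψ) m₂(Ψ)` for `Ψ ≥ 0` (route item
  stmt-AtomisticToContinuum-4370, provers' business); the extraction of a.e.-convergent
  subsequences from `L²`-convergence feeding `meanSelfDensity_le_liminf`; the value `27/8` for the
  free Dirichlet gas.

## References

* [LSSY2005] E. H. Lieb, R. Seiringer, J. P. Solovej, J. Yngvason, *The Mathematics of the Bose Gas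
  and its Condensation*, Birkhäuser 2005, §1.2 (1.17)–(1.19) (one-particle density matrix, BEC).
* [HolroydSoo2013] A. E. Holroyd, T. Soo, *Insertion and deletion tolerance of point processes*,
  Electron. J. Probab. 18 (2013), Thms. 1.1–1.2.
* [PenroseOnsager1956] O. Penrose, L. Onsager, Phys. Rev. 104 (1956) 576.
-/

noncomputable section

open MeasureTheory Filter
open scoped ENNReal NNReal ComplexConjugate

namespace Literature.MathematicalPhysics.QuantumManyBody.BoseGas

variable {n : ℕ}

/-! ### The definition -/

/-- The **mean self-conditional density** `m₂(Ψ) = L³ ∫ dY ∫ dx |Ψ(x,Y)|⁴ / ∫ dx' |Ψ(x',Y)|²` of an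
`(n+1)`-body wave function `Ψ` in a box of side `L`, `X = (x, Y)` split into the first particle
`x ∈ ℝ³` and the bath `Y ∈ (ℝ³)ⁿ`: `L³` times the Born-law expectation of the conditional density
`p(x₁ | x₂, …, x_N)` of one particle given the others; for normalised `Ψ` supported in `Λ_L^{n+1}`
it equals `1 + χ²(law of (x₁, rest) ‖ uniform ⊗ marginal)`. `ℝ≥0∞`-valued, `0/0 = 0` for bath
configurations where `Ψ(·, Y)` vanishes. [folklore] -/
def meanSelfDensity (n : ℕ) (L : ℝ) (Ψ : Config (n + 1) → ℂ) : ℝ≥0∞ :=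
  ENNReal.ofReal (L ^ 3) * ∫⁻ Y : Config n, ∫⁻ x : Space,
    (‖Ψ (Matrix.vecCons x Y)‖₊ : ℝ≥0∞) ^ 4 /
      (∫⁻ x' : Space, (‖Ψ (Matrix.vecCons x' Y)‖₊ : ℝ≥0∞) ^ 2)

/-- The **periodic twin**: the mean self-conditional density of a wave function on the torus of
side `L`, all integrals restricted to the fundamental cell `[0,L)³` — by definition `m₂` of
`1_{cell^{n+1}} Ψ` (the indicator convention of `condensateOccupation`); see
`periodicMeanSelfDensity_eq` for the unfolding. [folklore] -/
def periodicMeanSelfDensity (n : ℕ) (L : ℝ) (Ψ : Config (n + 1) → ℂ) : ℝ≥0∞ :=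
  meanSelfDensity n L ((cellN (n + 1) L).indicator Ψ)

/-- Unfolding of `meanSelfDensity` (the term inlined by route `BECDeletionTolerance`; `rfl`).
[folklore] -/
theorem meanSelfDensity_eq (n : ℕ) (L : ℝ) (Ψ : Config (n + 1) → ℂ) :
    meanSelfDensity n L Ψ = ENNReal.ofReal (L ^ 3) * (∫⁻ Y : Config n, ∫⁻ x : Space,
      (‖Ψ (Matrix.vecCons x Y)‖₊ : ℝ≥0∞) ^ 4 /
        (∫⁻ x' : Space, (‖Ψ (Matrix.vecCons x' Y)‖₊ : ℝ≥0∞) ^ 2)) :=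
  rfl

/-- Unfolding of `periodicMeanSelfDensity` (`rfl`). [folklore] -/
theorem periodicMeanSelfDensity_eq (n : ℕ) (L : ℝ) (Ψ : Config (n + 1) → ℂ) :
    periodicMeanSelfDensity n L Ψ = meanSelfDensity n L ((cellN (n + 1) L).indicator Ψ) :=
  rfl

/-! ### Invariances -/

/-- `m₂(Ψ)` depends on `Ψ` only through `|Ψ|`. [folklore] -/
theorem meanSelfDensity_congr_nnnorm {L : ℝ} {Ψ Φ : Config (n + 1) → ℂ}
    (h : ∀ X, ‖Ψ X‖₊ = ‖Φ X‖₊) : meanSelfDensity n L Ψ = meanSelfDensity n L Φ := by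
  simp only [meanSelfDensity, h]

/-- `m₂(|Ψ|) = m₂(Ψ)`. [folklore] -/
theorem meanSelfDensity_norm {L : ℝ} (Ψ : Config (n + 1) → ℂ) :
    meanSelfDensity n L (fun X => ((‖Ψ X‖ : ℝ) : ℂ)) = meanSelfDensity n L Ψ :=
  meanSelfDensity_congr_nnnorm fun X => NNReal.eq <| by simp

/-- `m₂(conj Ψ) = m₂(Ψ)`. [folklore] -/
theorem meanSelfDensity_conj {L : ℝ} (Ψ : Config (n + 1) → ℂ) :
    meanSelfDensity n L (fun X => conj (Ψ X)) = meanSelfDensity n L Ψ :=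
  meanSelfDensity_congr_nnnorm fun X => NNReal.eq <| by simp

/-- Homogeneity: `m₂(c Ψ) = |c|² m₂(Ψ)` (numerator of degree `4`, denominator of degree `2`; for
`c = 0` both sides vanish). [folklore] -/
theorem meanSelfDensity_const_mul {L : ℝ} (c : ℂ) (Ψ : Config (n + 1) → ℂ) :
    meanSelfDensity n L (fun X => c * Ψ X) = (‖c‖₊ : ℝ≥0∞) ^ 2 * meanSelfDensity n L Ψ := by
  rcases eq_or_ne c 0 with rfl | hc
  · simp [meanSelfDensity]
  have hc0 : (‖c‖₊ : ℝ≥0∞) ≠ 0 := by simpa using hc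
  have hc2 : (‖c‖₊ : ℝ≥0∞) ^ 2 ≠ ⊤ := ENNReal.pow_ne_top ENNReal.coe_ne_top
  have key : ∀ a D : ℝ≥0∞, (‖c‖₊ : ℝ≥0∞) ^ 4 * a / ((‖c‖₊ : ℝ≥0∞) ^ 2 * D) =
      (‖c‖₊ : ℝ≥0∞) ^ 2 * (a / D) := by
    intro a D
    rw [show (4 : ℕ) = 2 + 2 from rfl, pow_add, mul_assoc, mul_div_assoc,
      ENNReal.mul_div_mul_left _ _ (pow_ne_zero _ hc0) hc2]
  simp only [meanSelfDensity, nnnorm_mul, ENNReal.coe_mul, mul_pow]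
  have hin : ∀ Y : Config n,
      ∫⁻ x', (‖c‖₊ : ℝ≥0∞) ^ 2 * (‖Ψ (Matrix.vecCons x' Y)‖₊ : ℝ≥0∞) ^ 2 =
        (‖c‖₊ : ℝ≥0∞) ^ 2 * ∫⁻ x', (‖Ψ (Matrix.vecCons x' Y)‖₊ : ℝ≥0∞) ^ 2 := fun Y =>
    lintegral_const_mul' _ _ hc2
  have hout : ∀ Y : Config n,
      ∫⁻ x, (‖c‖₊ : ℝ≥0∞) ^ 2 * ((‖Ψ (Matrix.vecCons x Y)‖₊ : ℝ≥0∞) ^ 4 /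
        ∫⁻ x', (‖Ψ (Matrix.vecCons x' Y)‖₊ : ℝ≥0∞) ^ 2) =
        (‖c‖₊ : ℝ≥0∞) ^ 2 * ∫⁻ x, (‖Ψ (Matrix.vecCons x Y)‖₊ : ℝ≥0∞) ^ 4 /
          ∫⁻ x', (‖Ψ (Matrix.vecCons x' Y)‖₊ : ℝ≥0∞) ^ 2 := fun Y =>
    lintegral_const_mul' _ _ hc2
  simp_rw [hin, key, hout]
  rw [lintegral_const_mul' _ _ hc2, mul_left_comm]

/-- Phase invariance: `m₂(c Ψ) = m₂(Ψ)` for `|c| = 1` (e.g. `c = e^{iθ}`). [folklore] -/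
theorem meanSelfDensity_const_mul_of_norm_eq_one {L : ℝ} {c : ℂ} (hc : ‖c‖ = 1)
    (Ψ : Config (n + 1) → ℂ) :
    meanSelfDensity n L (fun X => c * Ψ X) = meanSelfDensity n L Ψ := by
  have h1 : ‖c‖₊ = 1 := NNReal.eq <| by rw [coe_nnnorm, hc, NNReal.coe_one]
  rw [meanSelfDensity_const_mul, h1, ENNReal.coe_one, one_pow, one_mul]

/-! ### Disintegration along the first particle -/

/-- `(x, Y) ↦ (x, Y)` as a point of `(ℝ³)^{n+1}` is measurable. [folklore] -/
theorem measurable_vecCons_prod :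
    Measurable fun z : Space × Config n => (Matrix.vecCons z.1 z.2 : Config (n + 1)) :=
  measurable_pi_lambda _ fun i => by
    cases i using Fin.cases with
    | zero => simpa using measurable_fst
    | succ j =>
        simp only [Matrix.cons_val_succ]
        exact (measurable_pi_apply j).comp measurable_snd

/-- `x ↦ (x, Y)` is measurable for fixed bath `Y`. [folklore] -/
theorem measurable_vecCons_left (Y : Config n) :
    Measurable fun x : Space => (Matrix.vecCons x Y : Config (n + 1)) :=
  measurable_vecCons_prod.comp (measurable_id.prodMk measurable_const)

/-- **Disintegration along the first particle** (Tonelli): `∫ F(X) dX = ∫ dY ∫ dx F(x, Y)` for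
measurable `F ≥ 0` on `(ℝ³)^{n+1}`. [folklore] -/
theorem lintegral_eq_lintegral_lintegral_vecCons {F : Config (n + 1) → ℝ≥0∞} (hF : Measurable F) :
    ∫⁻ X, F X = ∫⁻ Y : Config n, ∫⁻ x : Space, F (Matrix.vecCons x Y) := by
  have hmp := volume_preserving_piFinSuccAbove (fun _ : Fin (n + 1) => Space) 0
  rw [hmp.symm.lintegral_map_equiv F]
  have he : ∀ z : Space × Config n,
      (MeasurableEquiv.piFinSuccAbove (fun _ : Fin (n + 1) => Space) 0).symm z =
        Matrix.vecCons z.1 z.2 := by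
    rintro ⟨x, Y⟩
    change Fin.insertNth 0 x Y = (Fin.cons x Y : Config (n + 1))
    exact Fin.insertNth_zero' x Y
  simp_rw [he]
  rw [Measure.volume_eq_prod]
  exact lintegral_prod_symm' _ (hF.comp measurable_vecCons_prod)

/-- The bath marginal `Y ↦ ∫ dx F(x, Y)` is measurable. [folklore] -/
theorem measurable_lintegral_vecCons {F : Config (n + 1) → ℝ≥0∞} (hF : Measurable F) :
    Measurable fun Y : Config n => ∫⁻ x : Space, F (Matrix.vecCons x Y) :=
  (hF.comp measurable_vecCons_prod).lintegral_prod_left'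

/-! ### The Jensen lower bound `1 ≤ m₂` -/

/-- Cauchy–Schwarz: `∫ f g ≤ (∫ f²)^{1/2} (∫ g²)^{1/2}`. [folklore] -/
private theorem lintegral_mul_le_sqrt_mul_sqrt_aux {α : Type*} [MeasurableSpace α] (ν : Measure α)
    {f g : α → ℝ≥0∞} (hf : AEMeasurable f ν) (hg : AEMeasurable g ν) :
    ∫⁻ a, f a * g a ∂ν ≤ (∫⁻ a, f a ^ 2 ∂ν) ^ (1 / 2 : ℝ) * (∫⁻ a, g a ^ 2 ∂ν) ^ (1 / 2 : ℝ) := by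
  have h := ENNReal.lintegral_mul_le_Lp_mul_Lq ν Real.HolderConjugate.two_two hf hg
  simpa only [Pi.mul_apply, ENNReal.rpow_two] using h

/-- Squared Cauchy–Schwarz: `(∫ f g)² ≤ (∫ f²) (∫ g²)`. [folklore] -/
private theorem sq_lintegral_mul_le {α : Type*} [MeasurableSpace α] (ν : Measure α)
    {f g : α → ℝ≥0∞} (hf : AEMeasurable f ν) (hg : AEMeasurable g ν) :
    (∫⁻ a, f a * g a ∂ν) ^ 2 ≤ (∫⁻ a, f a ^ 2 ∂ν) * (∫⁻ a, g a ^ 2 ∂ν) := by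
  have hsq : ∀ a : ℝ≥0∞, (a ^ (1 / 2 : ℝ)) ^ 2 = a := fun a => by
    rw [← ENNReal.rpow_two, ← ENNReal.rpow_mul]; norm_num
  calc (∫⁻ a, f a * g a ∂ν) ^ 2
      ≤ ((∫⁻ a, f a ^ 2 ∂ν) ^ (1 / 2 : ℝ) * (∫⁻ a, g a ^ 2 ∂ν) ^ (1 / 2 : ℝ)) ^ 2 := by
        gcongr; exact lintegral_mul_le_sqrt_mul_sqrt_aux ν hf hg
    _ = _ := by rw [mul_pow, hsq, hsq]

/-- One-body Cauchy–Schwarz/Jensen: if `f` vanishes off `S` then `(∫ |f|²)² ≤ |S| ∫ |f|⁴`.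
[folklore] -/
theorem sq_lintegral_nnnorm_sq_le {S : Set Space} (hS : MeasurableSet S) {f : Space → ℂ}
    (hf : Measurable f) (h0 : ∀ x, x ∉ S → f x = 0) :
    (∫⁻ x, (‖f x‖₊ : ℝ≥0∞) ^ 2) ^ 2 ≤ volume S * ∫⁻ x, (‖f x‖₊ : ℝ≥0∞) ^ 4 := by
  have hind : ∀ x, (‖f x‖₊ : ℝ≥0∞) ^ 2 = S.indicator 1 x * (‖f x‖₊ : ℝ≥0∞) ^ 2 := by
    intro x
    by_cases hx : x ∈ S
    · simp [hx]
    · simp [hx, h0 x hx]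
  have hmeas : Measurable fun x => (‖f x‖₊ : ℝ≥0∞) ^ 2 :=
    hf.nnnorm.coe_nnreal_ennreal.pow_const _
  have h1m : AEMeasurable (S.indicator (1 : Space → ℝ≥0∞)) volume :=
    (measurable_const.indicator hS).aemeasurable
  calc (∫⁻ x, (‖f x‖₊ : ℝ≥0∞) ^ 2) ^ 2
      = (∫⁻ x, S.indicator 1 x * (‖f x‖₊ : ℝ≥0∞) ^ 2) ^ 2 := by
        congr 1; exact lintegral_congr fun x => hind x
    _ ≤ (∫⁻ x, (S.indicator (1 : Space → ℝ≥0∞) x) ^ 2) *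
          ∫⁻ x, ((‖f x‖₊ : ℝ≥0∞) ^ 2) ^ 2 := sq_lintegral_mul_le volume h1m hmeas.aemeasurable
    _ = volume S * ∫⁻ x, (‖f x‖₊ : ℝ≥0∞) ^ 4 := by
        congr 1
        · rw [← lintegral_indicator_one hS]
          refine lintegral_congr fun x => ?_
          by_cases hx : x ∈ S <;> simp [hx]
        · refine lintegral_congr fun x => ?_
          rw [← pow_mul]

/-- **Jensen lower bound.** If `Ψ` is measurable and normalised and every slice `Ψ(·, Y)` vanishes
off a measurable set `S ⊂ ℝ³` of volume `|S| ≤ L³`, then `1 ≤ m₂(Ψ)`: by Cauchy–Schwarz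
`b(Y)² ≤ |S| a(Y)` with `b = ∫|Ψ(·,Y)|²`, `a = ∫|Ψ(·,Y)|⁴`, hence
`1 = ∫ b ≤ L³ ∫ a/b = m₂` (equivalently `χ² ≥ 0`). [folklore] -/
theorem one_le_meanSelfDensity_of_support {L : ℝ} {S : Set Space} (hS : MeasurableSet S)
    (hSL : volume S ≤ ENNReal.ofReal (L ^ 3)) {Ψ : Config (n + 1) → ℂ} (hΨ : Measurable Ψ)
    (h0 : ∀ (x : Space) (Y : Config n), x ∉ S → Ψ (Matrix.vecCons x Y) = 0)
    (h1 : ∫⁻ X, (‖Ψ X‖₊ : ℝ≥0∞) ^ 2 = 1) :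
    1 ≤ meanSelfDensity n L Ψ := by
  have hNm : Measurable fun X => (‖Ψ X‖₊ : ℝ≥0∞) := hΨ.nnnorm.coe_nnreal_ennreal
  -- the bath marginal `b` integrates to `1` (Tonelli), hence is finite a.e.
  have hb1 : ∫⁻ Y : Config n, ∫⁻ x : Space, (‖Ψ (Matrix.vecCons x Y)‖₊ : ℝ≥0∞) ^ 2 = 1 := by
    rw [← h1, lintegral_eq_lintegral_lintegral_vecCons (hNm.pow_const 2)]
  have hbm : Measurable fun Y : Config n =>
      ∫⁻ x : Space, (‖Ψ (Matrix.vecCons x Y)‖₊ : ℝ≥0∞) ^ 2 :=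
    measurable_lintegral_vecCons (hNm.pow_const 2)
  have hfin : ∀ᵐ Y : Config n, ∫⁻ x : Space, (‖Ψ (Matrix.vecCons x Y)‖₊ : ℝ≥0∞) ^ 2 < ⊤ :=
    ae_lt_top hbm (by rw [hb1]; exact ENNReal.one_ne_top)
  -- slice-wise Cauchy–Schwarz
  have hCS : ∀ Y : Config n, (∫⁻ x : Space, (‖Ψ (Matrix.vecCons x Y)‖₊ : ℝ≥0∞) ^ 2) ^ 2 ≤
      ENNReal.ofReal (L ^ 3) * ∫⁻ x : Space, (‖Ψ (Matrix.vecCons x Y)‖₊ : ℝ≥0∞) ^ 4 :=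
    fun Y => (sq_lintegral_nnnorm_sq_le hS (hΨ.comp (measurable_vecCons_left Y))
      (fun x hx => h0 x Y hx)).trans (mul_le_mul' hSL le_rfl)
  -- rewrite `m₂` as `∫ dY (L³ a(Y)) / b(Y)`
  have hm : meanSelfDensity n L Ψ = ∫⁻ Y : Config n, ENNReal.ofReal (L ^ 3) *
      (∫⁻ x : Space, (‖Ψ (Matrix.vecCons x Y)‖₊ : ℝ≥0∞) ^ 4) /
        ∫⁻ x : Space, (‖Ψ (Matrix.vecCons x Y)‖₊ : ℝ≥0∞) ^ 2 := by
    rw [meanSelfDensity, ← lintegral_const_mul' _ _ ENNReal.ofReal_ne_top]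
    refine lintegral_congr fun Y => ?_
    rw [mul_div_assoc]
    congr 1
    have h4m : Measurable fun x : Space => (‖Ψ (Matrix.vecCons x Y)‖₊ : ℝ≥0∞) ^ 4 :=
      (hNm.pow_const 4).comp (measurable_vecCons_left Y)
    simp only [div_eq_mul_inv]
    rw [lintegral_mul_const _ h4m]
  rw [hm, ← hb1]
  refine lintegral_mono_ae (hfin.mono fun Y hY => ?_)
  rcases eq_or_ne (∫⁻ x : Space, (‖Ψ (Matrix.vecCons x Y)‖₊ : ℝ≥0∞) ^ 2) 0 with hb0 | hb0
  · rw [hb0]; exact zero_le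
  · rw [ENNReal.le_div_iff_mul_le (Or.inl hb0) (Or.inl hY.ne), ← sq]
    exact hCS Y

/-- `(x, Y) ∈ Λ_L^{n+1}` forces `x ∈ Λ_L`. [folklore] -/
theorem mem_box_of_vecCons_mem_boxN {L : ℝ} {x : Space} {Y : Config n}
    (h : Matrix.vecCons x Y ∈ boxN (n + 1) L) : x ∈ box L := by
  simpa using h 0

/-- `(x, Y) ∈ cell^{n+1}` forces `x ∈ cell`. [folklore] -/
theorem mem_cell_of_vecCons_mem_cellN {L : ℝ} {x : Space} {Y : Config n}
    (h : Matrix.vecCons x Y ∈ cellN (n + 1) L) : x ∈ cell L := by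
  simpa using h 0

/-- `(x, Y) ∈ cell^{n+1}` iff `x ∈ cell` and `Y ∈ cellⁿ`. [folklore] -/
theorem vecCons_mem_cellN_iff {L : ℝ} {x : Space} {Y : Config n} :
    Matrix.vecCons x Y ∈ cellN (n + 1) L ↔ x ∈ cell L ∧ Y ∈ cellN n L := by
  simp only [cellN, Set.mem_setOf_eq, Fin.forall_fin_succ, Matrix.cons_val_zero,
    Matrix.cons_val_succ]

/-- `|Λ_L| ≤ L³` (with equality; only the inequality is needed here, via `Λ_L ⊆ [0,L)³`).
[folklore] -/
theorem volume_box_le (L : ℝ) : volume (box L) ≤ ENNReal.ofReal (L ^ 3) := by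
  rcases le_or_gt L 0 with hL | hL
  · have : box L = ∅ := by
      ext x
      simp only [box, Set.mem_setOf_eq, Set.mem_Ioo, Set.mem_empty_iff_false, iff_false,
        not_forall, not_and, not_lt]
      exact ⟨0, fun h => (hL.trans h.le)⟩
    simp [this]
  · calc volume (box L) ≤ volume (cell L) :=
          measure_mono fun x hx k => Set.Ioo_subset_Ico_self (hx k)
      _ = ENNReal.ofReal (L ^ 3) := by rw [volume_cell, ENNReal.ofReal_pow hL.le]

/-- `|[0,L)³| ≤ L³` in the form needed here. [folklore] -/
theorem volume_cell_le (L : ℝ) : volume (cell L) ≤ ENNReal.ofReal (L ^ 3) := by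
  rcases le_or_gt L 0 with hL | hL
  · rw [volume_cell, ENNReal.ofReal_of_nonpos hL]; simp
  · rw [volume_cell, ENNReal.ofReal_pow hL.le]

/-- **`1 ≤ m₂` in the Dirichlet box**: a measurable, normalised `Ψ` vanishing off `Λ_L^{n+1}` has
mean self-conditional density at least `1` (the hypotheses of route item `DeletionBound`).
[folklore] -/
theorem one_le_meanSelfDensity_of_boxN {L : ℝ} {Ψ : Config (n + 1) → ℂ} (hΨ : Measurable Ψ)
    (h0 : ∀ X, X ∉ boxN (n + 1) L → Ψ X = 0) (h1 : ∫⁻ X, (‖Ψ X‖₊ : ℝ≥0∞) ^ 2 = 1) :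
    1 ≤ meanSelfDensity n L Ψ := by
  -- `box L` is measurable (also `measurableSet_box` in `LiebYngvasonCellMethod`, not imported here)
  have hbox : MeasurableSet (box L) := by
    have : box L = ⋂ k : Fin 3, (fun x : Space => x k) ⁻¹' Set.Ioo 0 L := by
      ext x; simp [box]
    rw [this]
    exact MeasurableSet.iInter fun k => measurableSet_Ioo.preimage (by fun_prop)
  exact one_le_meanSelfDensity_of_support hbox (volume_box_le L) hΨ
    (fun _ _ hx => h0 _ fun h => hx (mem_box_of_vecCons_mem_boxN h)) h1

/-- **`1 ≤ m₂` on the periodic cell**: a measurable `Ψ`, normalised on and vanishing off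
`[0,L)^{3(n+1)}`, has `1 ≤ m₂(Ψ)`. [folklore] -/
theorem one_le_meanSelfDensity_of_cellN {L : ℝ} {Ψ : Config (n + 1) → ℂ} (hΨ : Measurable Ψ)
    (h0 : ∀ X, X ∉ cellN (n + 1) L → Ψ X = 0) (h1 : ∫⁻ X, (‖Ψ X‖₊ : ℝ≥0∞) ^ 2 = 1) :
    1 ≤ meanSelfDensity n L Ψ :=
  one_le_meanSelfDensity_of_support (measurableSet_cell L) (volume_cell_le L) hΨ
    (fun _ _ hx => h0 _ fun h => hx (mem_cell_of_vecCons_mem_cellN h)) h1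

/-! ### Product states -/

/-- **Product states.** For a normalised one-body mode `φ` (`∫|φ|² = 1`),
`m₂(φ ⊗ ⋯ ⊗ φ) = L³ ∫ |φ|⁴`: the conditional density of one particle given the others is `|φ|²`
itself. [folklore] -/
theorem meanSelfDensity_prod (L : ℝ) {φ : Space → ℂ} (hφ : Measurable φ)
    (h1 : ∫⁻ x, (‖φ x‖₊ : ℝ≥0∞) ^ 2 = 1) :
    meanSelfDensity n L (fun X => ∏ i, φ (X i)) =
      ENNReal.ofReal (L ^ 3) * ∫⁻ x, (‖φ x‖₊ : ℝ≥0∞) ^ 4 := by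
  have hNm : Measurable fun x => (‖φ x‖₊ : ℝ≥0∞) := hφ.nnnorm.coe_nnreal_ennreal
  rw [meanSelfDensity]
  congr 1
  have hsplit : ∀ (x : Space) (Y : Config n),
      (‖∏ i, φ (Matrix.vecCons x Y i)‖₊ : ℝ≥0∞) =
        (‖φ x‖₊ : ℝ≥0∞) * ∏ i, (‖φ (Y i)‖₊ : ℝ≥0∞) := by
    intro x Y
    rw [Fin.prod_univ_succ]
    simp only [Matrix.cons_val_zero, Matrix.cons_val_succ, nnnorm_mul, nnnorm_prod,
      ENNReal.coe_mul, ENNReal.ofNNReal_finsetProd]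
  have hden : ∀ Y : Config n,
      ∫⁻ x' : Space, ((‖φ x'‖₊ : ℝ≥0∞) * ∏ i, (‖φ (Y i)‖₊ : ℝ≥0∞)) ^ 2 =
        (∏ i, (‖φ (Y i)‖₊ : ℝ≥0∞)) ^ 2 := by
    intro Y
    simp_rw [mul_pow]
    rw [lintegral_mul_const _ (hNm.pow_const _), h1, one_mul]
  have hpt : ∀ (x : Space) (Y : Config n),
      ((‖φ x‖₊ : ℝ≥0∞) * ∏ i, (‖φ (Y i)‖₊ : ℝ≥0∞)) ^ 4 / (∏ i, (‖φ (Y i)‖₊ : ℝ≥0∞)) ^ 2 =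
        (‖φ x‖₊ : ℝ≥0∞) ^ 4 * (∏ i, (‖φ (Y i)‖₊ : ℝ≥0∞)) ^ 2 := by
    intro x Y
    rcases eq_or_ne (∏ i, (‖φ (Y i)‖₊ : ℝ≥0∞)) 0 with hP | hP
    · simp [hP]
    · have hPt : (∏ i, (‖φ (Y i)‖₊ : ℝ≥0∞)) ≠ ⊤ :=
        ENNReal.prod_ne_top fun i _ => ENNReal.coe_ne_top
      rw [mul_pow, show (∏ i, (‖φ (Y i)‖₊ : ℝ≥0∞)) ^ 4 = (∏ i, (‖φ (Y i)‖₊ : ℝ≥0∞)) ^ 2 *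
          (∏ i, (‖φ (Y i)‖₊ : ℝ≥0∞)) ^ 2 by rw [← pow_add], ← mul_assoc,
        ENNReal.mul_div_cancel_right (pow_ne_zero _ hP) (ENNReal.pow_ne_top hPt)]
  have hprod : ∫⁻ Y : Config n, (∏ i, (‖φ (Y i)‖₊ : ℝ≥0∞)) ^ 2 = 1 := by
    simp_rw [← Finset.prod_pow]
    rw [volume_pi, Literature.Probability.Distributions.lintegral_fin_nat_prod_eq_prod
      (fun _ => volume) (fun _ x => (‖φ x‖₊ : ℝ≥0∞) ^ 2) (fun _ => hNm.pow_const _)]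
    simp [h1]
  have hPm : Measurable fun Y : Config n => (∏ i, (‖φ (Y i)‖₊ : ℝ≥0∞)) ^ 2 :=
    (Finset.measurable_prod _ fun i _ => hNm.comp (measurable_pi_apply i)).pow_const _
  simp only [hsplit, hden, hpt]
  simp_rw [lintegral_mul_const _ (hNm.pow_const 4)]
  rw [lintegral_const_mul _ hPm, hprod, mul_one]

/-- `‖L^{-3/2}‖ₑ² = (L³)⁻¹`. [folklore] -/
private theorem nnnorm_invSqrt_sq {L : ℝ} (hL : 0 < L) :
    ((‖((Real.sqrt (L ^ 3))⁻¹ : ℂ)‖₊ : ℝ≥0∞) ^ 2) = (ENNReal.ofReal (L ^ 3))⁻¹ := by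
  have hL3 : 0 < L ^ 3 := by positivity
  have hc : ((‖((Real.sqrt (L ^ 3))⁻¹ : ℂ)‖₊ : ℝ≥0∞) ^ 2) = ENNReal.ofReal ((L ^ 3)⁻¹) := by
    rw [← ENNReal.coe_pow, ENNReal.ofReal, ENNReal.coe_inj]
    ext
    rw [NNReal.coe_pow, coe_nnnorm, norm_inv, Complex.norm_real,
      Real.norm_of_nonneg (Real.sqrt_nonneg _), inv_pow, Real.sq_sqrt hL3.le,
      Real.coe_toNNReal _ (by positivity)]
  rw [hc, ENNReal.ofReal_inv_of_pos hL3]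

/-- **The free periodic gas.** The constant state `Ψ = (L^{-3/2} 1_{cell})^{⊗(n+1)}` (ground state
of the non-interacting gas on the torus) has `m₂ = 1`: the lower bound
`one_le_meanSelfDensity_of_cellN` is attained. [folklore] -/
theorem meanSelfDensity_prod_constantMode {L : ℝ} (hL : 0 < L) :
    meanSelfDensity n L (fun X => ∏ i, constantMode L (X i)) = 1 := by
  have hL3 : ENNReal.ofReal (L ^ 3) ≠ 0 := by
    rw [ENNReal.ofReal_ne_zero_iff]; positivity
  have hmeas : Measurable (constantMode L) := measurable_const.indicator (measurableSet_cell L)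
  have hpow : ∀ k : ℕ, k ≠ 0 → ∀ x : Space, (‖constantMode L x‖₊ : ℝ≥0∞) ^ (2 * k) =
      (cell L).indicator (fun _ => ((ENNReal.ofReal (L ^ 3))⁻¹) ^ k) x := by
    intro k hk x
    by_cases hx : x ∈ cell L
    · simp only [constantMode, Set.indicator_of_mem hx, pow_mul, nnnorm_invSqrt_sq hL]
    · simp only [constantMode, Set.indicator_of_notMem hx, nnnorm_zero, ENNReal.coe_zero]
      exact zero_pow (by omega)
  have hint : ∀ k : ℕ, k ≠ 0 → ∫⁻ x, (‖constantMode L x‖₊ : ℝ≥0∞) ^ (2 * k) =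
      ((ENNReal.ofReal (L ^ 3))⁻¹) ^ k * ENNReal.ofReal (L ^ 3) := by
    intro k hk
    simp_rw [hpow k hk]
    rw [lintegral_indicator_const (measurableSet_cell L), volume_cell, ENNReal.ofReal_pow hL.le]
  have h2 : ∫⁻ x, (‖constantMode L x‖₊ : ℝ≥0∞) ^ 2 = 1 := by
    have := hint 1 one_ne_zero
    rw [mul_one, pow_one, ENNReal.inv_mul_cancel hL3 ENNReal.ofReal_ne_top] at this
    exact this
  have h4 : ∫⁻ x, (‖constantMode L x‖₊ : ℝ≥0∞) ^ 4 = (ENNReal.ofReal (L ^ 3))⁻¹ := by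
    have := hint 2 two_ne_zero
    rw [show 2 * 2 = 4 from rfl, sq, mul_assoc,
      ENNReal.inv_mul_cancel hL3 ENNReal.ofReal_ne_top, mul_one] at this
    exact this
  rw [meanSelfDensity_prod L hmeas h2, h4, ENNReal.mul_inv_cancel hL3 ENNReal.ofReal_ne_top]


/-! ### Lower semicontinuity (Fatou) -/

/-- `Fin.tail (x, Y) = Y`. [folklore] -/
theorem tail_vecCons (x : Space) (Y : Config n) : Fin.tail (Matrix.vecCons x Y) = Y :=
  funext fun i => by simp [Fin.tail]

/-- The bath map `X = (x, Y) ↦ Y` is measurable. [folklore] -/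
theorem measurable_tail : Measurable (Fin.tail : Config (n + 1) → Config n) :=
  measurable_pi_lambda _ fun _ => measurable_pi_apply _

/-- The bath map `X = (x, Y) ↦ Y` is quasi-measure-preserving (null sets pull back to null sets:
`|ℝ³ × E| = ∞ · 0 = 0`). [folklore] -/
theorem quasiMeasurePreserving_tail :
    Measure.QuasiMeasurePreserving (Fin.tail : Config (n + 1) → Config n) volume volume := by
  have hmp := volume_preserving_piFinSuccAbove (fun _ : Fin (n + 1) => Space) 0
  have h2 : Measure.QuasiMeasurePreserving (Prod.snd : Space × Config n → Config n)
      volume volume := by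
    rw [Measure.volume_eq_prod]
    exact Measure.quasiMeasurePreserving_snd
  exact h2.comp hmp.quasiMeasurePreserving

/-- `m₂` as a single integral over `(ℝ³)^{n+1}`:
`m₂(Ψ) = L³ ∫ dX |Ψ(X)|⁴ / b(Y(X))`, `b(Y) = ∫ dx' |Ψ(x', Y)|²`. [folklore] -/
theorem meanSelfDensity_eq_lintegral {L : ℝ} {Ψ : Config (n + 1) → ℂ} (hΨ : Measurable Ψ) :
    meanSelfDensity n L Ψ = ENNReal.ofReal (L ^ 3) * ∫⁻ X, (‖Ψ X‖₊ : ℝ≥0∞) ^ 4 /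
      ∫⁻ x', (‖Ψ (Matrix.vecCons x' (Fin.tail X))‖₊ : ℝ≥0∞) ^ 2 := by
  have hN : Measurable fun X => (‖Ψ X‖₊ : ℝ≥0∞) := hΨ.nnnorm.coe_nnreal_ennreal
  have hG : Measurable fun X : Config (n + 1) => (‖Ψ X‖₊ : ℝ≥0∞) ^ 4 /
      ∫⁻ x', (‖Ψ (Matrix.vecCons x' (Fin.tail X))‖₊ : ℝ≥0∞) ^ 2 :=
    (hN.pow_const 4).div ((measurable_lintegral_vecCons (hN.pow_const 2)).comp measurable_tail)
  rw [meanSelfDensity, lintegral_eq_lintegral_lintegral_vecCons hG]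
  simp only [tail_vecCons]

/-- **Lower semicontinuity of `m₂` (Fatou).** If measurable `Ψ_k → Φ` almost everywhere on
`(ℝ³)^{n+1}` and the bath marginals converge almost everywhere,
`∫|Ψ_k(x, Y)|² dx → ∫|Φ(x, Y)|² dx` for a.e. `Y` (both hold along a subsequence of any
`L²`-convergent sequence), then `m₂(Φ) ≤ liminf_k m₂(Ψ_k)`. Pointwise the integrands
`|Ψ_k|⁴ / b_k` converge to `|Φ|⁴ / b` wherever `(|Φ|⁴, b) ≠ (0, 0)` (`ENNReal` division is
continuous there, with value `⊤` at `b = 0`), and the limit integrand is `0` where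
`(|Φ|⁴, b) = (0, 0)`; Fatou's lemma concludes. [folklore] -/
theorem meanSelfDensity_le_liminf {L : ℝ} {Ψ : ℕ → Config (n + 1) → ℂ} {Φ : Config (n + 1) → ℂ}
    (hΨ : ∀ k, Measurable (Ψ k)) (hΦ : Measurable Φ)
    (hlim : ∀ᵐ X : Config (n + 1), Tendsto (fun k => Ψ k X) atTop (nhds (Φ X)))
    (hmarg : ∀ᵐ Y : Config n, Tendsto
      (fun k => ∫⁻ x, (‖Ψ k (Matrix.vecCons x Y)‖₊ : ℝ≥0∞) ^ 2) atTop
      (nhds (∫⁻ x, (‖Φ (Matrix.vecCons x Y)‖₊ : ℝ≥0∞) ^ 2))) :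
    meanSelfDensity n L Φ ≤ liminf (fun k => meanSelfDensity n L (Ψ k)) atTop := by
  have hN : ∀ k, Measurable fun X => (‖Ψ k X‖₊ : ℝ≥0∞) := fun k =>
    (hΨ k).nnnorm.coe_nnreal_ennreal
  have hGk : ∀ k, Measurable fun X : Config (n + 1) => (‖Ψ k X‖₊ : ℝ≥0∞) ^ 4 /
      ∫⁻ x', (‖Ψ k (Matrix.vecCons x' (Fin.tail X))‖₊ : ℝ≥0∞) ^ 2 := fun k =>
    ((hN k).pow_const 4).div
      ((measurable_lintegral_vecCons ((hN k).pow_const 2)).comp measurable_tail)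
  -- pull the convergence of the bath marginals back along `X ↦ Y`
  have hmarg' := quasiMeasurePreserving_tail.ae hmarg
  -- single-integral forms and `liminf (c · u) = c · liminf u`
  have hrw : (fun k => meanSelfDensity n L (Ψ k)) = fun k => ENNReal.ofReal (L ^ 3) *
      ∫⁻ X, (‖Ψ k X‖₊ : ℝ≥0∞) ^ 4 /
        ∫⁻ x', (‖Ψ k (Matrix.vecCons x' (Fin.tail X))‖₊ : ℝ≥0∞) ^ 2 :=
    funext fun k => meanSelfDensity_eq_lintegral (hΨ k)
  rw [meanSelfDensity_eq_lintegral hΦ, hrw,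
    ENNReal.liminf_const_mul_of_ne_top ENNReal.ofReal_ne_top]
  refine mul_le_mul' le_rfl (le_trans (lintegral_mono_ae ?_)
    (lintegral_liminf_le' fun k => (hGk k).aemeasurable))
  filter_upwards [hlim, hmarg'] with X hX hbX
  have ha : Tendsto (fun k => (‖Ψ k X‖₊ : ℝ≥0∞) ^ 4) atTop (nhds ((‖Φ X‖₊ : ℝ≥0∞) ^ 4)) :=
    ((ENNReal.continuous_pow 4).tendsto _).comp (ENNReal.tendsto_coe.2 hX.nnnorm)
  by_cases h00 : (‖Φ X‖₊ : ℝ≥0∞) ^ 4 = 0 ∧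
      ∫⁻ x', (‖Φ (Matrix.vecCons x' (Fin.tail X))‖₊ : ℝ≥0∞) ^ 2 = 0
  · rw [h00.1, ENNReal.zero_div]
    exact zero_le
  · exact (ENNReal.Tendsto.div ha (not_and_or.mp h00) hbX
      (Or.inr (ENNReal.pow_ne_top ENNReal.coe_ne_top))).liminf_eq.ge

end Literature.MathematicalPhysics.QuantumManyBody.BoseGas

end
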